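import Literature.NumberTheory.GaloisRepresentations.LubinTateColemanRelativeInterpolationTwo
import Literature.NumberTheory.GaloisRepresentations.LubinTateColemanRelativeAnomalyTwo
import Literature.NumberTheory.GaloisRepresentations.LubinTateComparisonReflectionTwo
import Mathlib.RingTheory.RootsOfUnity.PrimitiveRoots
import Mathlib.NumberTheory.DirichletCharacter.Basic
import Mathlib.Data.Nat.Factorization.Basic
import Mathlib.Analysis.Normed.Ring.Ultra
import HarnessLib

set_option autoImplicit false

/-!
# R222 «SHIFT₂» in the `evS` currency (`ϑ(−2 − z) = −π' − ϑ(z)` at the `2`-power torsion), and the two R219-INST₂ leaves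
# H1 «HALF-LIFT» (`P ≡ 1 (mod 2)` ⇒ `P = 1 + 2y`) and H3 «Λ₂-LIFT» (`Σ (−1)^d 2^d/(d+1) X^{d+1} ∈ 𝒪_ℂ⟦X⟧`)

Cell `bsd-print-cf2`, typer `bsd-print-cf2-ty2` g45 (literature-prover seat; typer directory `Rank1Residual/P2/`, Theses-free, no
item): port P53 (Summits half) of STUB-PLAN `stub_heegnerIndexLowerAtTwo` (crux `PrintCf2.SplitBadTwoLowerHalfOfFacts`,
stmt-BirchSwinnertonDyer-27851; CRITIC-ROWS-g42 rows 120–121; sketch k2-g41 `cd4b39d39d1ff210` §B, §D, §E VERBATIM and critic g42's R222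
field side `shift₂` / `exists_shift₂`).  HONEST FRAMING: nothing here proves BSD, the crux or the stub; no named fact, no `sorry`; the
two definitions (`lamCoeff`, `Lam2C`) are explicit integral elements / series.  The character half of the index side
(`χ(1 + 2^n) = −1`, the kernel `{1, γ₀}` of `(ℤ/2^{n+1})ˣ → (ℤ/2^n)ˣ`) is `Literature.NumberTheory.LFunctions.TwoPowerConductorKernel`; the
assembly with R221 «EVAL₂» (`ReadTwoCut.read_value_eq_tsum_lamTerm`, critic J10) and the instantiated REFL sum are filed with the INST₂ core (P58).

* §0 index side (k3-g41 §7, k2-g41 §B/§C): `refl_table_charSum`, `pow_two_pow_eq_neg_one`, `neg_pow_eq_pow_add_two_pow`,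
  ★ `pow_add_two_pow_sub_one` (`ζ^{j+2^n} − 1 = −2 − (ζ^j − 1)`), `odd_mul_one_add_two_pow_modEq`, `odd_mul_gamma0_zmod`,
  `pow_mul_one_add_two_pow_eq_neg`, `pow_mul_one_add_two_pow_sub_one`.
* §1 R222 field side: `evS_compSeriesC_shift`, `evS_compSeriesC_shift_negTwo`, `exists_pt_coe_eq_pow_sub_one`, ★ `shift₂`, `exists_shift₂`.
* §2 H3 «Λ₂-LIFT»: `norm_natCast_eq_one_of_odd`, `norm_two_pow_div_le_one` (`‖2^d/(d+1)‖ ≤ 1`), `lamCoeff`, `Lam2C`, `coeff_zero_Lam2C`,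
  `coeff_succ_Lam2C`, ★ `exists_Lam2_lift`, `exists_Lam2_lift_map`, `map_coeff_Lam2C`, `exists_Lam2_lift_map_frame`.
* §3 H1 «HALF-LIFT»: ★ `exists_eq_one_add_C_mul`.

References: [deShalit1987] I.3.2 (p. 17), I.3.3 (7)–(7′); [LubinTate1965] (16)–(18); `p^d/(d+1) ∈ ℤ_p`: [Washington1997] §5.1.
-/

noncomputable section

namespace Summit.BirchSwinnertonDyer.Rank1Residual.P2.ShiftLift

/-! ## §0. R222 «SHIFT₂», INDEX SIDE (pure algebra): the REFL-table character sum and the index shift on `μ_{2^{n+1}}` -/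

section IndexSide

/-- The REFL-table character sum (critic g41's B72 certificate, generic): for a character `ψ` with `ψ(γ₀) = −1`, `γ₀² = 1`,
and any table `T`, `Σ_γ ψ(γ)·κ(T γ − T(γγ₀)) = 2κ Σ_γ ψ(γ) T γ` (reindex `γ ↦ γγ₀`). -/
theorem refl_table_charSum {R' : Type*} [CommRing R'] {N : ℕ} [NeZero N] {Γ : Type*} [Group Γ] [Fintype Γ]
    (e : Γ ≃* (ZMod N)ˣ) (ψ : MulChar (ZMod N) R') (T : Γ → R') (κ : R') (γ₀ : Γ)
    (hγ₀ : γ₀ * γ₀ = 1) (hψ : ψ ((e γ₀ : (ZMod N)ˣ) : ZMod N) = -1) :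
    ∑ γ : Γ, ψ ((e γ : (ZMod N)ˣ) : ZMod N) * (κ * (T γ - T (γ * γ₀))) =
      2 * κ * ∑ γ : Γ, ψ ((e γ : (ZMod N)ˣ) : ZMod N) * T γ := by
  have hre : ∑ γ : Γ, ψ ((e γ : (ZMod N)ˣ) : ZMod N) * T (γ * γ₀) =
      ∑ δ : Γ, ψ ((e (δ * γ₀) : (ZMod N)ˣ) : ZMod N) * T δ := by
    refine (Fintype.sum_equiv (Equiv.mulRight γ₀)
      (fun δ => ψ ((e (δ * γ₀) : (ZMod N)ˣ) : ZMod N) * T δ)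
      (fun γ => ψ ((e γ : (ZMod N)ˣ) : ZMod N) * T (γ * γ₀)) (fun δ => ?_)).symm
    simp only [Equiv.coe_mulRight, mul_assoc, hγ₀, mul_one]
  have hneg : ∀ δ : Γ, ψ ((e (δ * γ₀) : (ZMod N)ˣ) : ZMod N) = -ψ ((e δ : (ZMod N)ˣ) : ZMod N) := by
    intro δ
    rw [map_mul, Units.val_mul, map_mul, hψ, mul_neg, mul_one]
  have hsplit : ∀ γ : Γ, ψ ((e γ : (ZMod N)ˣ) : ZMod N) * (κ * (T γ - T (γ * γ₀))) =
      κ * (ψ ((e γ : (ZMod N)ˣ) : ZMod N) * T γ) - κ * (ψ ((e γ : (ZMod N)ˣ) : ZMod N) * T (γ * γ₀)) := by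
    intro γ; ring
  simp_rw [hsplit]
  rw [Finset.sum_sub_distrib, ← Finset.mul_sum, ← Finset.mul_sum, hre]
  simp_rw [hneg, neg_mul, Finset.sum_neg_distrib]
  ring

/-! ### Primitive `2^{n+1}`-th roots of unity: `ζ^{2^n} = −1`, and the index shift is `ζ^j ↦ −ζ^j` -/

variable {R : Type*} [CommRing R] [NoZeroDivisors R]

/-- A primitive `2^{n+1}`-th root of unity has `ζ^{2^n} = −1` (Mathlib `IsPrimitiveRoot.eq_neg_one_of_two_right`). -/
theorem pow_two_pow_eq_neg_one {n : ℕ} {ζ : R} (hζ : IsPrimitiveRoot ζ (2 ^ (n + 1))) : ζ ^ 2 ^ n = -1 :=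
  (hζ.pow (Nat.two_pow_pos _) (pow_succ 2 n)).eq_neg_one_of_two_right

/-- `−ζ^j = ζ^{j + 2^n}`: the reflection `ε ↦ −ε` is the index shift `j ↦ j + 2^n` on `μ_{2^{n+1}}`. -/
theorem neg_pow_eq_pow_add_two_pow {n : ℕ} {ζ : R} (hζ : IsPrimitiveRoot ζ (2 ^ (n + 1))) (j : ℕ) :
    -ζ ^ j = ζ ^ (j + 2 ^ n) := by
  rw [pow_add, pow_two_pow_eq_neg_one hζ, mul_neg_one]

/-- SHIFT₂, `Ĝ_m` side: `ζ^{j+2^n} − 1 = −2 − (ζ^j − 1)` — the hypothesis `hx'` of the tree's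
`LubinTate.coe_evalPt₁_compSeriesC_reflect` with `x = ζ^j − 1`, `x' = ζ^{j+2^n} − 1`. -/
theorem pow_add_two_pow_sub_one {n : ℕ} {ζ : R} (hζ : IsPrimitiveRoot ζ (2 ^ (n + 1))) (j : ℕ) :
    ζ ^ (j + 2 ^ n) - 1 = -2 - (ζ ^ j - 1) := by
  rw [← neg_pow_eq_pow_add_two_pow hζ j]; ring

/-- On the INDEX group the reflection `j ↦ j + 2^n` of an odd index is MULTIPLICATION by `γ₀ = 1 + 2^n`
(not by `−1`; the `−1` above is the field element `ζ^{2^n}`). -/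
theorem odd_mul_one_add_two_pow_modEq {n j : ℕ} (hj : Odd j) : j * (1 + 2 ^ n) ≡ j + 2 ^ n [MOD 2 ^ (n + 1)] := by
  obtain ⟨i, rfl⟩ := hj
  have h : (2 * i + 1) * (1 + 2 ^ n) = (2 * i + 1 + 2 ^ n) + 2 ^ (n + 1) * i := by ring
  rw [Nat.ModEq, h, Nat.add_mul_mod_self_left]

/-- The same in `ZMod (2^{n+1})`: `j·γ₀ = j + 2^n` for odd `j`. -/
theorem odd_mul_gamma0_zmod {n j : ℕ} (hj : Odd j) :
    (j : ZMod (2 ^ (n + 1))) * (1 + 2 ^ n) = j + 2 ^ n := by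
  have h := (ZMod.natCast_eq_natCast_iff _ _ _).mpr (odd_mul_one_add_two_pow_modEq (n := n) hj)
  push_cast at h
  exact h


/-- For `ζ` of exact order `2^{n+1}` and `j` odd, `ζ^{j(1+2^n)} = −ζ^j` — the REFL shift `j ↦ j·γ₀` is `ζ^j ↦ −ζ^j`,
i.e. `1 + z ↦ −(1 + z)` on `z_j = ζ^j − 1`. -/
theorem pow_mul_one_add_two_pow_eq_neg {n : ℕ} {ζ : R}
    (hζ : IsPrimitiveRoot ζ (2 ^ (n + 1))) {j : ℕ} (hj : Odd j) :
    ζ ^ (j * (1 + 2 ^ n)) = -ζ ^ j := by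
  have h1 : ζ ^ 2 ^ n = -1 :=
    (hζ.pow (by positivity) (show 2 ^ (n + 1) = 2 ^ n * 2 by rw [pow_succ])).eq_neg_one_of_two_right
  rw [mul_add, mul_one, pow_add, pow_mul', h1, hj.neg_one_pow]
  ring

/-- Hence the torsion points `z_j := ζ^j − 1` satisfy `z_{jγ₀} = −2 − z_j`. -/
theorem pow_mul_one_add_two_pow_sub_one {n : ℕ} {ζ : R}
    (hζ : IsPrimitiveRoot ζ (2 ^ (n + 1))) {j : ℕ} (hj : Odd j) :
    ζ ^ (j * (1 + 2 ^ n)) - 1 = -2 - (ζ ^ j - 1) := by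
  rw [pow_mul_one_add_two_pow_eq_neg hζ hj]; ring

end IndexSide


/-! ## §1. R222 «SHIFT₂» — the torsion dictionary `ϑ(−2 − x) = −π' − ϑ(x)` in the `evS` currency -/

section ShiftTwo

open ValuativeRel IsLocalRing Field IsNonarchimedeanLocalField
open Literature.NumberTheory.GaloisRepresentations Literature.NumberTheory.GaloisRepresentations.IsNonarchimedeanLocalField
  Literature.NumberTheory.GaloisRepresentations.LubinTate Literature.NumberTheory.PAdicHodge

variable {F : Type} [Field F] [ValuativeRel F] [TopologicalSpace F] [IsNonarchimedeanLocalField F]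
variable (hq : residueFieldCard F = 2) (h2 : (valuation F).IsUniformizer (((2 : ℕ) : 𝒪[F]) : F))
  {σ₀ : absoluteGaloisGroup F} (hσ₀ : IsAbsArithFrob σ₀) (u : 𝒪[F]ˣ)
  {ε : (maxUnramifiedCompletion F)ˣ}
  (hε : maxUnramifiedCompletion.galAut F σ₀ (ε : maxUnramifiedCompletion F) =
    algebraMap 𝒪[F] (maxUnramifiedCompletion F) (u : 𝒪[F]) * (ε : maxUnramifiedCompletion F))

include hq in
/-- ★ **R222 «SHIFT₂» in the `evS` currency of R219-INST₂**:
for points `z, z'` of `𝔪_ℂ` with `1 + z' = −(1 + z)` (i.e. `z' = z [+]_{Ĝ_m} (−2)`),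
`ϑ(z') = −π' − ϑ(z) = ϑ(z) [+]_{f'} ω₁'` with `ω₁' = −π' = ϑ(−2)` (`f' = π'X + X²`, `π' = 2u`;
`y [+]_{f'} (−π') = −π' − y`).  Dictionary: de Shalit I.3.3 (7)–(7′) `θ(ς(1+S) − 1) = θ(S) [+] ω`, `ς = −1`
↦ tree ★★ `coe_evalPt₁_compSeriesC_reflect` + `evalPt₁_compSeriesC_eq_mk_evS`. -/
theorem evS_compSeriesC_shift (z z' : (maxNilIdealC F).toIdeal)
    (hz' : ((z' : CBall F) : CompletedAlgClosure F) = -2 - ((z : CBall F) : CompletedAlgClosure F)) :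
    ((evS (maxNilIdealC F) z' ((compSeriesC h2 hσ₀ u hε).map (algebraMap (UnrCoeff F) (CBall F))) : CBall F) :
        CompletedAlgClosure F) =
      -algebraMap F (CompletedAlgClosure F) ((((u : 𝒪[F]) * ((2 : ℕ) : 𝒪[F]) : 𝒪[F]) : F)) -
        ((evS (maxNilIdealC F) z ((compSeriesC h2 hσ₀ u hε).map (algebraMap (UnrCoeff F) (CBall F))) : CBall F) :
          CompletedAlgClosure F) := by
  have h := coe_evalPt₁_compSeriesC_reflect hq h2 hσ₀ u hε z z' hz'
  rw [evalPt₁_compSeriesC_eq_mk_evS hσ₀ u hε h2 z', evalPt₁_compSeriesC_eq_mk_evS hσ₀ u hε h2 z] at h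
  exact h

include hq in
/-- R222, point form with the torsion point NAMED: for the point `t = −2` of `𝔪_ℂ` (`ϑ(t) = −π' = ω₁'`, tree
`coe_evalPt₁_compSeriesC_negTwo`), `ϑ(z') = ϑ(t) − ϑ(z)` whenever `z' = −2 − z`. -/
theorem evS_compSeriesC_shift_negTwo (t z z' : (maxNilIdealC F).toIdeal)
    (ht : ((t : CBall F) : CompletedAlgClosure F) = -2)
    (hz' : ((z' : CBall F) : CompletedAlgClosure F) = -2 - ((z : CBall F) : CompletedAlgClosure F)) :
    ((evS (maxNilIdealC F) z' ((compSeriesC h2 hσ₀ u hε).map (algebraMap (UnrCoeff F) (CBall F))) : CBall F) :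
        CompletedAlgClosure F) =
      ((evS (maxNilIdealC F) t ((compSeriesC h2 hσ₀ u hε).map (algebraMap (UnrCoeff F) (CBall F))) : CBall F) :
          CompletedAlgClosure F) -
        ((evS (maxNilIdealC F) z ((compSeriesC h2 hσ₀ u hε).map (algebraMap (UnrCoeff F) (CBall F))) : CBall F) :
          CompletedAlgClosure F) := by
  have ht' := coe_evalPt₁_compSeriesC_negTwo hq h2 hσ₀ u hε t ht
  rw [evalPt₁_compSeriesC_eq_mk_evS hσ₀ u hε h2 t] at ht'
  rw [evS_compSeriesC_shift hq h2 hσ₀ u hε z z' hz']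
  change _ = ((evS (maxNilIdealC F) t ((compSeriesC h2 hσ₀ u hε).map (algebraMap (UnrCoeff F) (CBall F))) :
    CBall F) : CompletedAlgClosure F) - _
  rw [show ((evS (maxNilIdealC F) t ((compSeriesC h2 hσ₀ u hε).map (algebraMap (UnrCoeff F) (CBall F))) :
    CBall F) : CompletedAlgClosure F) = -algebraMap F (CompletedAlgClosure F)
      ((((u : 𝒪[F]) * ((2 : ℕ) : 𝒪[F]) : 𝒪[F]) : F)) from ht']

include h2 in
/-- The `2`-power torsion points `ζ^j − 1` of `Ĝ_m` lie in `𝔪_ℂ`. -/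
theorem exists_pt_coe_eq_pow_sub_one {ζ : CompletedAlgClosure F} {n : ℕ} (hζ : ζ ^ 2 ^ n = 1) (j : ℕ) :
    ∃ x : (maxNilIdealC F).toIdeal, ((x : CBall F) : CompletedAlgClosure F) = ζ ^ j - 1 :=
  exists_pt_coe_eq (norm_sub_one_lt_one_of_pow_two_pow_eq_one (n := n) (norm_two_lt_one_C h2)
    (by rw [← pow_mul, mul_comm, pow_mul, hζ, one_pow]))

include hq in
/-- ★ **R222 SHIFT₂ (field side) CLOSED**: for a primitive `2^{n+1}`-th root of unity `ζ ∈ ℂ_F` and torsion points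
`x = ζ^j − 1`, `x' = ζ^{j+2^n} − 1` of `𝔪_ℂ`: `ϑ(x') = −π' − ϑ(x)` (`= ϑ(x) [+]_{f'} ω₁'`, `ω₁' = ϑ(−2) = −π'`, `π' = 2u`). -/
theorem shift₂ {ζ : CompletedAlgClosure F} {n : ℕ} (hζ : IsPrimitiveRoot ζ (2 ^ (n + 1))) (j : ℕ)
    (x x' : (maxNilIdealC F).toIdeal) (hx : ((x : CBall F) : CompletedAlgClosure F) = ζ ^ j - 1)
    (hx' : ((x' : CBall F) : CompletedAlgClosure F) = ζ ^ (j + 2 ^ n) - 1) :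
    (((evalPt₁ (maxNilIdealC F) (compSeriesC h2 hσ₀ u hε) (constantCoeff_compSeriesC h2 hσ₀ u hε) x' :
        (maxNilIdealC F).toIdeal) : CBall F) : CompletedAlgClosure F) =
      -algebraMap F (CompletedAlgClosure F) ((((u : 𝒪[F]) * ((2 : ℕ) : 𝒪[F]) : 𝒪[F]) : F)) -
        (((evalPt₁ (maxNilIdealC F) (compSeriesC h2 hσ₀ u hε) (constantCoeff_compSeriesC h2 hσ₀ u hε) x :
          (maxNilIdealC F).toIdeal) : CBall F) : CompletedAlgClosure F) :=
  coe_evalPt₁_compSeriesC_reflect hq h2 hσ₀ u hε x x'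
    (by rw [hx', hx, pow_add_two_pow_sub_one hζ j])

include hq in
/-- The same with the torsion points PRODUCED (no point hypotheses left). -/
theorem exists_shift₂ {ζ : CompletedAlgClosure F} {n : ℕ} (hζ : IsPrimitiveRoot ζ (2 ^ (n + 1))) (j : ℕ) :
    ∃ x x' : (maxNilIdealC F).toIdeal,
      ((x : CBall F) : CompletedAlgClosure F) = ζ ^ j - 1 ∧
      ((x' : CBall F) : CompletedAlgClosure F) = ζ ^ (j + 2 ^ n) - 1 ∧
      (((evalPt₁ (maxNilIdealC F) (compSeriesC h2 hσ₀ u hε) (constantCoeff_compSeriesC h2 hσ₀ u hε) x' :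
          (maxNilIdealC F).toIdeal) : CBall F) : CompletedAlgClosure F) =
        -algebraMap F (CompletedAlgClosure F) ((((u : 𝒪[F]) * ((2 : ℕ) : 𝒪[F]) : 𝒪[F]) : F)) -
          (((evalPt₁ (maxNilIdealC F) (compSeriesC h2 hσ₀ u hε) (constantCoeff_compSeriesC h2 hσ₀ u hε) x :
            (maxNilIdealC F).toIdeal) : CBall F) : CompletedAlgClosure F) := by
  obtain ⟨x, hx⟩ := exists_pt_coe_eq_pow_sub_one h2 hζ.pow_eq_one j
  obtain ⟨x', hx'⟩ := exists_pt_coe_eq_pow_sub_one h2 hζ.pow_eq_one (j + 2 ^ n)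
  exact ⟨x, x', hx, hx', shift₂ hq h2 hσ₀ u hε hζ j x x' hx hx'⟩

end ShiftTwo

/-! ## §2. H3 «Λ₂-LIFT» in residue characteristic 2: the coefficients `(−1)^d 2^d/(d+1)` of `Λ₂ = ½·log(1+2X)` lie in `𝒪_{ℂ_F}`
(`d+1 = 2^v·m`, `m` odd, `2^v ≤ d+1 ≤ 2^d`; any ultrametric field with `‖2‖ < 1`) -/

section LamTwoLift

/-- Odd naturals are units in norm: `‖m‖ = 1` for `m` odd, in any ultrametric normed field with `‖2‖ < 1`. -/
theorem norm_natCast_eq_one_of_odd {L : Type*} [NormedField L] [IsUltrametricDist L] (h2 : ‖(2 : L)‖ < 1)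
    {m : ℕ} (hm : Odd m) : ‖(m : L)‖ = 1 := by
  obtain ⟨k, rfl⟩ := hm
  have hk : ‖(2 * k : L)‖ < 1 := by
    rw [norm_mul]
    calc ‖(2 : L)‖ * ‖(k : L)‖ ≤ ‖(2 : L)‖ * 1 := by
          gcongr
          exact IsUltrametricDist.norm_natCast_le_one L k
      _ < 1 := by rw [mul_one]; exact h2
  have hne : ‖(2 * k : L)‖ ≠ ‖(1 : L)‖ := by rw [norm_one]; exact hk.ne
  rw [Nat.cast_add, Nat.cast_mul, Nat.cast_two, Nat.cast_one,
    IsUltrametricDist.norm_add_eq_max_of_norm_ne_norm hne, norm_one, max_eq_right hk.le]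

/-- ★ `‖2^d/(d+1)‖ ≤ 1` (`d+1 = 2^v·m`, `m` odd, `2^v ≤ d+1 ≤ 2^d`). -/
theorem norm_two_pow_div_le_one {L : Type*} [NormedField L] [IsUltrametricDist L] (h2 : ‖(2 : L)‖ < 1)
    (d : ℕ) : ‖(2 : L) ^ d / ((d : L) + 1)‖ ≤ 1 := by
  obtain ⟨v, m, hm, hvm⟩ := Nat.exists_eq_two_pow_mul_odd (Nat.succ_ne_zero d)
  have hd1 : ((d : L) + 1) = (2 : L) ^ v * (m : L) := by
    have h := congrArg (Nat.cast : ℕ → L) hvm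
    push_cast at h
    exact h
  have hv : v ≤ d := by
    have h1 : 2 ^ v ≤ d + 1 := by
      calc 2 ^ v ≤ 2 ^ v * m := Nat.le_mul_of_pos_right _ hm.pos
        _ = d + 1 := hvm.symm
    exact (Nat.pow_le_pow_iff_right (by norm_num)).mp (h1.trans Nat.lt_two_pow_self)
  rw [norm_div, hd1, norm_mul, norm_natCast_eq_one_of_odd h2 hm, mul_one, norm_pow, norm_pow]
  exact div_le_one_of_le₀ (pow_le_pow_of_le_one (norm_nonneg _) h2.le hv) (by positivity)

open ValuativeRel
open Literature.NumberTheory.GaloisRepresentations Literature.NumberTheory.GaloisRepresentations.IsNonarchimedeanLocalField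
  Literature.NumberTheory.GaloisRepresentations.LubinTate Literature.NumberTheory.PAdicHodge

variable {F : Type} [Field F] [ValuativeRel F] [TopologicalSpace F] [IsNonarchimedeanLocalField F]

/-- The `Λ₂`-coefficient `(−1)^d 2^d/(d+1)` as an element of `𝒪_{ℂ_F}`. -/
def lamCoeff (h2 : ‖(2 : CompletedAlgClosure F)‖ < 1) (d : ℕ) : CBall F :=
  ⟨(-1) ^ d * (2 : CompletedAlgClosure F) ^ d / ((d : CompletedAlgClosure F) + 1),
    (mem_unitBall_iff _).mpr (by
      rw [mul_div_assoc, norm_mul, norm_pow, norm_neg, norm_one, one_pow, one_mul]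
      exact norm_two_pow_div_le_one h2 d)⟩

/-- The integral lift `L = Σ_{d≥0} (−1)^d 2^d/(d+1) · X^{d+1} ∈ 𝒪_{ℂ_F}⟦X⟧` of `Λ₂ = ½ log(1 + 2X)`. -/
def Lam2C (h2 : ‖(2 : CompletedAlgClosure F)‖ < 1) : PowerSeries (CBall F) :=
  PowerSeries.mk fun n => if n = 0 then 0 else lamCoeff h2 (n - 1)

/-- `L(0) = 0`. -/
theorem coeff_zero_Lam2C (h2 : ‖(2 : CompletedAlgClosure F)‖ < 1) : PowerSeries.coeff 0 (Lam2C h2) = 0 := by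
  rw [Lam2C, PowerSeries.coeff_mk, if_pos rfl]

/-- `[X^{d+1}]L = (−1)^d 2^d/(d+1)`. -/
theorem coeff_succ_Lam2C (h2 : ‖(2 : CompletedAlgClosure F)‖ < 1) (d : ℕ) :
    ((PowerSeries.coeff (d + 1) (Lam2C h2) : CBall F) : CompletedAlgClosure F) =
      (-1) ^ d * (2 : CompletedAlgClosure F) ^ d / ((d : CompletedAlgClosure F) + 1) := by
  rw [Lam2C, PowerSeries.coeff_mk, if_neg (Nat.succ_ne_zero d), Nat.add_sub_cancel]
  rfl

/-- ★ **H3 «Λ₂-LIFT» PROVED**: in residue characteristic `2` (`‖2‖_{ℂ_F} < 1`, tree `norm_two_lt_one_C h2`)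
there is `L ∈ 𝒪_{ℂ_F}⟦X⟧` with `L(0) = 0` and `[X^{d+1}]L = (−1)^d 2^d/(d+1)`. -/
theorem exists_Lam2_lift (h2 : ‖(2 : CompletedAlgClosure F)‖ < 1) :
    ∃ L : PowerSeries (CBall F), ((PowerSeries.coeff 0 L : CBall F) : CompletedAlgClosure F) = 0 ∧
      ∀ d : ℕ, ((PowerSeries.coeff (d + 1) L : CBall F) : CompletedAlgClosure F) =
        (-1) ^ d * (2 : CompletedAlgClosure F) ^ d / ((d : CompletedAlgClosure F) + 1) :=
  ⟨Lam2C h2, by rw [coeff_zero_Lam2C]; rfl, coeff_succ_Lam2C h2⟩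

/-- ★ The same in the EXACT hypothesis shape of `ReadTwoCut.read_value_eq_tsum_lamTerm` (`hL0`, `hL`), for any ring
map `θ : ℂ_F → M` into a field (there `M = ℂ_[2]`). -/
theorem exists_Lam2_lift_map (h2 : ‖(2 : CompletedAlgClosure F)‖ < 1) {M : Type*} [Field M]
    (θ : CompletedAlgClosure F →+* M) :
    ∃ L : PowerSeries (CBall F), θ ((PowerSeries.coeff 0 L : CBall F) : CompletedAlgClosure F) = 0 ∧
      ∀ d : ℕ, θ ((PowerSeries.coeff (d + 1) L : CBall F) : CompletedAlgClosure F) =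
        (-1) ^ d * (2 : M) ^ d / ((d : M) + 1) := by
  refine ⟨Lam2C h2, ?_, fun d => ?_⟩
  · rw [coeff_zero_Lam2C]; exact map_zero θ
  · rw [coeff_succ_Lam2C, map_div₀, map_mul, map_pow, map_pow, map_neg, map_one, map_add, map_natCast, map_one,
      map_ofNat]

/-- ★ Coefficientwise form matching `ReadTwoCut.coeff_Lam2` (`Lam2 A := mk fun n ↦ if n = 0 then 0 else
algebraMap ℚ A ((−1)^{n+1} 2^{n−1}/n)`): under any ring map `θ` into a characteristic-0 field `M`,
`θ(L) = Lam2 M` coefficient by coefficient — i.e. `(Lam2C).map (θ ∘ subtype) = Lam2 M`. -/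
theorem map_coeff_Lam2C (h2 : ‖(2 : CompletedAlgClosure F)‖ < 1) {M : Type*} [Field M] [CharZero M]
    (θ : CompletedAlgClosure F →+* M) (n : ℕ) :
    θ ((PowerSeries.coeff n (Lam2C h2) : CBall F) : CompletedAlgClosure F) =
      if n = 0 then 0 else algebraMap ℚ M ((-1 : ℚ) ^ (n + 1) * 2 ^ (n - 1) / n) := by
  cases n with
  | zero => rw [if_pos rfl, coeff_zero_Lam2C]; exact map_zero θ
  | succ d =>
    rw [if_neg (Nat.succ_ne_zero d), coeff_succ_Lam2C, map_div₀, map_mul, map_pow, map_pow, map_neg, map_one,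
      map_add, map_natCast, map_one, map_ofNat, Nat.add_sub_cancel, eq_ratCast]
    push_cast
    ring


/-- ★ H3 in the FRAME OF RECORD (`2` a uniformiser of `F`, so `‖2‖_ℂ < 1` by the tree's `norm_two_lt_one_C`). -/
theorem exists_Lam2_lift_map_frame (h2u : (valuation F).IsUniformizer (((2 : ℕ) : 𝒪[F]) : F)) {M : Type*} [Field M]
    (θ : CompletedAlgClosure F →+* M) :
    ∃ L : PowerSeries (CBall F), θ ((PowerSeries.coeff 0 L : CBall F) : CompletedAlgClosure F) = 0 ∧
      ∀ d : ℕ, θ ((PowerSeries.coeff (d + 1) L : CBall F) : CompletedAlgClosure F) =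
        (-1) ^ d * (2 : M) ^ d / ((d : M) + 1) :=
  exists_Lam2_lift_map (norm_two_lt_one_C h2u) θ

end LamTwoLift

/-! ## §3. H1 «HALF-LIFT»: a power series `P ≡ 1 (mod a)` coefficientwise with `P(0) = 1` is `1 + a·y` with `y(0) = 0` -/

section HalfLift

/-- ★ H1 «HALF-LIFT» (coefficientwise choice; any commutative ring, any modulus `a`). -/
theorem exists_eq_one_add_C_mul {A : Type*} [CommRing A] (a : A) (P : PowerSeries A)
    (hP0 : PowerSeries.constantCoeff P = 1) (hP : ∀ n : ℕ, a ∣ PowerSeries.coeff (n + 1) P) :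
    ∃ y : PowerSeries A, PowerSeries.constantCoeff y = 0 ∧ P = 1 + PowerSeries.C a * y := by
  classical
  choose c hc using hP
  refine ⟨PowerSeries.mk fun n => if n = 0 then 0 else c (n - 1), ?_, ?_⟩
  · rw [← PowerSeries.coeff_zero_eq_constantCoeff_apply, PowerSeries.coeff_mk, if_pos rfl]
  · ext n
    rw [map_add, PowerSeries.coeff_one, PowerSeries.coeff_C_mul, PowerSeries.coeff_mk]
    cases n with
    | zero => rw [if_pos rfl, if_pos rfl, mul_zero, add_zero, PowerSeries.coeff_zero_eq_constantCoeff_apply, hP0]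
    | succ k => rw [if_neg (Nat.succ_ne_zero k), if_neg (Nat.succ_ne_zero k), zero_add, Nat.add_sub_cancel, hc k]

end HalfLift

end Summit.BirchSwinnertonDyer.Rank1Residual.P2.ShiftLift

end
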